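import Mathlib.Geometry.Manifold.Instances.Sphere
import Mathlib.Geometry.Manifold.ContMDiff.Atlas
import Mathlib.Geometry.Manifold.MFDeriv.SpecificFunctions
import Literature.Geometry.Riemannian.GreatSphereFibrationSpread
import HarnessLib

/-!
# The homogeneous extension of a great-sphere fibration (towards Hähl 1987, Prop. 4.7)

Sibling proof file of `GreatSphereFibrationSpread.lean`, second step of the proof programme for the
corrected form of `Literature.Geometry.Riemannian.Hahl1987_greatSphereFibration_base_sphere`
(H. Hähl, Results Math. 12 (1987) 99–118, Prop. 4.7: the base of a smooth fibration of `S²ᵏ⁻¹` by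
great `(k-1)`-spheres is a twisted sphere). For a map `p : S(E) → M` on the unit sphere of a real
inner product space all of whose fibres are great spheres `S(E) ∩ V` we study the
**homogeneous extension** `𝒫 : E → M`, `𝒫 w = p (w/‖w‖)` (`coneExtension`), through which all
later charts of the base factor (Hähl's charts 2.9 are `a ↦ 𝒫 (e + a)` on a fibre subspace):

* `unitVec x₀ w = w/‖w‖` as a point of the sphere (junk value `x₀` at `w = 0`), smooth on `E ∖ 0`
  as a map into the manifold `S(E)` (`contMDiffAt_unitVec`);
* `𝒫` is constant on every punctured fibre subspace `V ∖ 0` (`coneExtension_eq_of_mem`), smooth on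
  `E ∖ 0` (`contMDiffAt_coneExtension`), and `𝒫 w = 𝒫 w'` iff `w' ∈ V_{w/‖w‖}`
  (`coneExtension_eq_iff`);
* **the kernel of `d𝒫`** (the linear-algebra heart of Hähl's 2.7, "the subspace spanned by the
  fibre `F_z` … is also spanned by the tangent space of the fibre together with the point itself"):
  for a smooth submersion `p` with `k`-dimensional fibre subspaces in `dim E = 2k`,
  `ker d𝒫_w = V_{w/‖w‖}` (`mfderiv_coneExtension_apply_eq_zero_iff`): `⊇` because `𝒫` is constant
  on `V ∖ 0`, `⊆` by counting dimensions, `d𝒫_w` being onto (`d(unitVec)_w` is onto since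
  `unitVec ∘ (‖w‖ • ι) = id` on the sphere, and `dp` is onto by hypothesis).

Everything is proved; the only definitions are `unitVec` and `coneExtension` (explicit, with the
documented junk value at `0`). No named facts.

## References

* [Hahl1987] H. Hähl, *Differentiable fibrations of the (2n-1)-sphere by great (n-1)-spheres and
  their coordinatization over quasifields*, Results Math. 12 (1987) 99–118 — 2.1, 2.7, 2.9.
* J. M. Lee, *Introduction to Smooth Manifolds*, 2nd ed. (2013), Ch. 4 (submersions; context).
-/

noncomputable section

open Set Function Module Submodule Metric
open scoped Manifold ContDiff Topology

namespace Literature.Geometry.Riemannian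

variable {E : Type*} [NormedAddCommGroup E] [InnerProductSpace ℝ E]

/-! ### Normalisation as a map into the sphere -/

open Classical in
/-- **Normalisation** `w ↦ w/‖w‖` as a map `E → S(E)` into the unit sphere, with the junk value
`x₀` at `w = 0` (the only point where `w/‖w‖` is not a unit vector). [folklore] -/
def unitVec (x₀ : sphere (0 : E) 1) (w : E) : sphere (0 : E) 1 :=
  if h : w = 0 then x₀ else ⟨‖w‖⁻¹ • w, mem_sphere_zero_iff_norm.2 (norm_smul_inv_norm (𝕜 := ℝ) h)⟩

variable {x₀ : sphere (0 : E) 1}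

/-- The value of the normalisation at `w ≠ 0`. [folklore] -/
theorem coe_unitVec {w : E} (hw : w ≠ 0) : (unitVec x₀ w : E) = ‖w‖⁻¹ • w := by
  rw [unitVec, dif_neg hw]

/-- A unit vector is its own normalisation. [folklore] -/
@[simp]
theorem unitVec_coe (y : sphere (0 : E) 1) : unitVec x₀ (y : E) = y := by
  have hy : (y : E) ≠ 0 := ne_zero_of_mem_unit_sphere y
  apply Subtype.ext
  rw [coe_unitVec hy, norm_eq_of_mem_sphere, inv_one, one_smul]

/-- Normalisation is constant on open rays: `unitVec (s • w) = unitVec w` for `s > 0`. [folklore] -/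
theorem unitVec_smul {w : E} (hw : w ≠ 0) {s : ℝ} (hs : 0 < s) :
    unitVec x₀ (s • w) = unitVec x₀ w := by
  have hsw : s • w ≠ 0 := smul_ne_zero hs.ne' hw
  apply Subtype.ext
  rw [coe_unitVec hsw, coe_unitVec hw, norm_smul, Real.norm_of_nonneg hs.le, mul_inv, smul_smul,
    mul_comm s⁻¹, mul_assoc, inv_mul_cancel₀ hs.ne', mul_one]

/-- Normalisation of the opposite vector is the antipode. [folklore] -/
theorem unitVec_neg {w : E} (hw : w ≠ 0) : unitVec x₀ (-w) = -unitVec x₀ w := by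
  apply Subtype.ext
  rw [coe_unitVec (neg_ne_zero.2 hw), coe_neg_sphere, coe_unitVec hw, norm_neg, smul_neg]

/-- `‖w‖ • unitVec w = w`. [folklore] -/
theorem norm_smul_coe_unitVec {w : E} (hw : w ≠ 0) : ‖w‖ • (unitVec x₀ w : E) = w := by
  rw [coe_unitVec hw, smul_smul, mul_inv_cancel₀ (norm_ne_zero_iff.2 hw), one_smul]

/-- **Normalisation is smooth away from the origin** as a map into the manifold `S(E)`: on the
open submanifold `{w ≠ 0}` it is the restriction to the sphere of the smooth `E`-valued map
`w ↦ ‖w‖⁻¹ • w` (Mathlib's `ContMDiff.codRestrict_sphere`). [folklore] -/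
theorem contMDiffAt_unitVec {d : ℕ} [Fact (finrank ℝ E = d + 1)] {m : WithTop ℕ∞} {w : E}
    (hw : w ≠ 0) : ContMDiffAt 𝓘(ℝ, E) (𝓡 d) m (unitVec x₀) w := by
  let U : TopologicalSpace.Opens E := ⟨{v : E | v ≠ 0}, isOpen_ne⟩
  have hU : ∀ v : U, (v : E) ≠ 0 := fun v => v.2
  -- the `E`-valued normalisation is smooth on the open submanifold `U`
  have h1 : ContMDiff 𝓘(ℝ, E) 𝓘(ℝ, E) m (fun v : U => ‖(v : E)‖⁻¹ • (v : E)) := by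
    intro v
    have h : ContMDiffAt 𝓘(ℝ, E) 𝓘(ℝ, E) m (fun z : E => ‖z‖⁻¹ • z) (v : E) := by
      have hn : ContDiffAt ℝ m (fun z : E => ‖z‖) (v : E) := contDiffAt_id.norm ℝ (hU v)
      exact ((hn.inv (norm_ne_zero_iff.2 (hU v))).smul contDiffAt_id).contMDiffAt
    exact (contMDiffAt_subtype_iff (U := U) (f := fun z : E => ‖z‖⁻¹ • z)).2 h
  have h2 : ∀ v : U, ‖(v : E)‖⁻¹ • (v : E) ∈ sphere (0 : E) 1 := fun v =>
    mem_sphere_zero_iff_norm.2 (norm_smul_inv_norm (𝕜 := ℝ) (hU v))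
  have h3 := h1.codRestrict_sphere (n := d) h2
  have h4 : (fun v : U => unitVec x₀ (v : E)) = Set.codRestrict _ _ h2 := by
    funext v
    apply Subtype.ext
    rw [coe_unitVec (hU v), val_codRestrict_apply]
  have h5 : ContMDiffAt 𝓘(ℝ, E) (𝓡 d) m (fun v : U => unitVec x₀ (v : E)) ⟨w, hw⟩ := by
    rw [h4]; exact h3 _
  exact (contMDiffAt_subtype_iff (U := U) (f := unitVec x₀) (x := ⟨w, hw⟩)).1 h5


/-- **The differential of the normalisation is onto** at every `w ≠ 0`: the smooth map
`y ↦ ‖w‖ • y` of the sphere into `E` is a right inverse of `unitVec` (`unitVec (‖w‖ • y) = y`), so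
by the chain rule `d(unitVec)_w ∘ d(‖w‖ • ι)_{w/‖w‖} = id`. [folklore] -/
theorem surjective_mfderiv_unitVec {d : ℕ} [Fact (finrank ℝ E = d + 1)] {w : E} (hw : w ≠ 0) :
    Surjective (mfderiv 𝓘(ℝ, E) (𝓡 d) (unitVec x₀) w) := by
  set y : sphere (0 : E) 1 := unitVec x₀ w with hy
  -- the section `g y' = ‖w‖ • y'`
  have hg : ContMDiff (𝓡 d) 𝓘(ℝ, E) ∞ (fun y' : sphere (0 : E) 1 => ‖w‖ • (y' : E)) :=
    (contDiff_const_smul ‖w‖).comp_contMDiff contMDiff_coe_sphere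
  have hgy : ‖w‖ • (y : E) = w := norm_smul_coe_unitVec hw
  have hsec : unitVec x₀ ∘ (fun y' : sphere (0 : E) 1 => ‖w‖ • (y' : E)) = id := by
    funext y'
    simp only [comp_apply, id_eq]
    rw [unitVec_smul (ne_zero_of_mem_unit_sphere y') (norm_pos_iff.2 hw), unitVec_coe]
  have h1 : MDifferentiableAt 𝓘(ℝ, E) (𝓡 d) (unitVec x₀) (‖w‖ • (y : E)) := by
    rw [hgy]
    exact (contMDiffAt_unitVec (m := 1) hw).mdifferentiableAt one_ne_zero
  have h2 : MDifferentiableAt (𝓡 d) 𝓘(ℝ, E) (fun y' : sphere (0 : E) 1 => ‖w‖ • (y' : E)) y :=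
    (hg y).mdifferentiableAt (by simp)
  have hcomp := mfderiv_comp y h1 h2
  rw [hsec, mfderiv_id, hgy] at hcomp
  intro v
  refine ⟨mfderiv (𝓡 d) 𝓘(ℝ, E) (fun y' : sphere (0 : E) 1 => ‖w‖ • (y' : E)) y v, ?_⟩
  have := congrArg (fun f => f v) hcomp
  exact this.symm

/-! ### The homogeneous extension `𝒫` of `p` -/

variable {M : Type*}

/-- **The homogeneous extension** `𝒫 w = p (w/‖w‖)` of a map `p` on the unit sphere to the whole
space (junk value `p x₀` at `w = 0`). For a great-sphere fibration `p`, Hähl's affine charts of the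
base (2.9) are the restrictions `a ↦ 𝒫 (e + a)` of `𝒫` to affine subspaces. [cite: Hahl1987, 2.9] -/
def coneExtension (p : sphere (0 : E) 1 → M) (x₀ : sphere (0 : E) 1) (w : E) : M :=
  p (unitVec x₀ w)

variable {p : sphere (0 : E) 1 → M}

/-- `𝒫` extends `p`. [folklore] -/
@[simp]
theorem coneExtension_coe (y : sphere (0 : E) 1) : coneExtension p x₀ (y : E) = p y := by
  rw [coneExtension, unitVec_coe]

/-- `𝒫` is constant on open rays. [folklore] -/
theorem coneExtension_smul {w : E} (hw : w ≠ 0) {s : ℝ} (hs : 0 < s) :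
    coneExtension p x₀ (s • w) = coneExtension p x₀ w := by
  rw [coneExtension, coneExtension, unitVec_smul hw hs]

/-- **`𝒫` is smooth away from the origin** when `p` is smooth (composition of `p` with the
normalisation). [cite: Hahl1987, 2.9] -/
theorem contMDiffAt_coneExtension {d : ℕ} [Fact (finrank ℝ E = d + 1)] {m : WithTop ℕ∞}
    {H' : Type*} [TopologicalSpace H'] {E' : Type*} [NormedAddCommGroup E'] [NormedSpace ℝ E']
    {I' : ModelWithCorners ℝ E' H'} [TopologicalSpace M] [ChartedSpace H' M]
    (hp : ContMDiff (𝓡 d) I' m p) {w : E} (hw : w ≠ 0) :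
    ContMDiffAt 𝓘(ℝ, E) I' m (coneExtension p x₀) w :=
  (hp _).comp w (contMDiffAt_unitVec hw)

section GreatFibres

variable {k : ℕ}
  (hfib : ∀ x, ∃ V : Submodule ℝ E, finrank ℝ V = k ∧
    p ⁻¹' {p x} = {y : sphere (0 : E) 1 | (y : E) ∈ V})
include hfib

/-- **`𝒫` is constant on each punctured fibre subspace**: a non-zero vector `v` of `V_y` is mapped
to `p y` (its normalisation is a point of the great sphere `S(E) ∩ V_y`, the fibre of `y`).
[cite: Hahl1987, 2.1] -/
theorem coneExtension_eq_of_mem {y : sphere (0 : E) 1} {v : E} (hv : v ≠ 0)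
    (hvy : v ∈ fibreSpan p y) : coneExtension p x₀ v = p y := by
  rw [coneExtension, ← mem_fibreSpan_iff hfib, coe_unitVec hv]
  exact smul_mem _ _ hvy

omit hfib in
/-- A non-zero vector lies in the fibre subspace of its own normalisation. [cite: Hahl1987, 2.1] -/
theorem mem_fibreSpan_unitVec {w : E} (hw : w ≠ 0) : w ∈ fibreSpan p (unitVec x₀ w) := by
  have h := smul_mem (fibreSpan p (unitVec x₀ w)) ‖w‖ (self_mem_fibreSpan (p := p) (unitVec x₀ w))
  rwa [norm_smul_coe_unitVec hw] at h

/-- **`𝒫 w = 𝒫 w'` iff `w'` lies in the fibre subspace of `w/‖w‖`** (`w' ≠ 0`; for `w = 0` both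
sides refer to the junk point `x₀`): the fibres of `𝒫` on `E ∖ 0` are the punctured fibre subspaces.
[cite: Hahl1987, 2.1] -/
theorem coneExtension_eq_iff (w : E) {w' : E} (hw' : w' ≠ 0) :
    coneExtension p x₀ w' = coneExtension p x₀ w ↔ w' ∈ fibreSpan p (unitVec x₀ w) := by
  constructor
  · intro h
    have h1 : w' ∈ fibreSpan p (unitVec x₀ w') := mem_fibreSpan_unitVec hw'
    rwa [fibreSpan_eq_of_apply_eq (p := p) (x := unitVec x₀ w) (y := unitVec x₀ w') h] at h1
  · intro h
    exact coneExtension_eq_of_mem hfib hw' h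

/-- `𝒫` is even: `𝒫 (-w) = 𝒫 w` (great spheres are symmetric under the antipodal map).
[cite: Hahl1987, 2.1] -/
theorem coneExtension_neg (w : E) : coneExtension p x₀ (-w) = coneExtension p x₀ w := by
  by_cases hw : w = 0
  · rw [hw, neg_zero]
  · exact (coneExtension_eq_iff hfib w (neg_ne_zero.2 hw)).2
      (neg_mem (mem_fibreSpan_unitVec hw))

/-- `𝒫` is constant on punctured lines: `𝒫 (s • w) = 𝒫 w` for every `s ≠ 0`. [cite: Hahl1987, 2.1] -/
theorem coneExtension_smul_of_ne_zero {w : E} {s : ℝ} (hs : s ≠ 0) :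
    coneExtension p x₀ (s • w) = coneExtension p x₀ w := by
  by_cases hw : w = 0
  · rw [hw, smul_zero]
  · exact (coneExtension_eq_iff hfib w (smul_ne_zero hs hw)).2
      (smul_mem _ _ (mem_fibreSpan_unitVec hw))

end GreatFibres


/-! ### The kernel of `d𝒫` -/

section Kernel

variable {d : ℕ} [Fact (finrank ℝ E = d + 1)] {k : ℕ}
  (hfib : ∀ x, ∃ V : Submodule ℝ E, finrank ℝ V = k ∧
    p ⁻¹' {p x} = {y : sphere (0 : E) 1 | (y : E) ∈ V})

set_option backward.isDefEq.respectTransparency false in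
/-- The derivative at `0` of the affine line `t ↦ w + t • v` applied to `1` is `v`. [folklore] -/
theorem mfderiv_lineMap_apply_one (w v : E) :
    mfderiv 𝓘(ℝ, ℝ) 𝓘(ℝ, E) (fun t : ℝ => w + t • v) 0 (1 : ℝ) = v := by
  have h : HasFDerivAt (fun t : ℝ => w + t • v)
      ((ContinuousLinearMap.id ℝ ℝ).smulRight v) 0 :=
    ((hasFDerivAt_id (0 : ℝ)).smul_const v).const_add w
  rw [mfderiv_eq_fderiv, h.fderiv]
  show ((ContinuousLinearMap.id ℝ ℝ).smulRight v) (1 : ℝ) = v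
  simp

include hfib in
set_option backward.isDefEq.respectTransparency false in
/-- **Fibre subspaces are killed by `d𝒫`**: if `v ∈ V_{w/‖w‖}` then `d𝒫_w v = 0`, because `𝒫` is
constant (`= 𝒫 w`) along the line `t ↦ w + t v ⊆ V_{w/‖w‖}` near `t = 0` (Hähl 2.7: the tangent
space of the fibre lies in the fibre subspace). [cite: Hahl1987, 2.7] -/
theorem mfderiv_coneExtension_apply_eq_zero {E' H' : Type*} [NormedAddCommGroup E']
    [NormedSpace ℝ E'] [TopologicalSpace H'] {I' : ModelWithCorners ℝ E' H'} [TopologicalSpace M]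
    [ChartedSpace H' M] (hp : ContMDiff (𝓡 d) I' 1 p) {w : E} (hw : w ≠ 0) {v : E}
    (hv : v ∈ fibreSpan p (unitVec x₀ w)) :
    mfderiv 𝓘(ℝ, E) I' (coneExtension p x₀) w v = 0 := by
  set ℓ : ℝ → E := fun t => w + t • v with hℓ
  have hℓ0 : ℓ 0 = w := by simp [hℓ]
  -- `𝒫 ∘ ℓ` is constant near `0`
  have hne : ∀ᶠ t in 𝓝 (0 : ℝ), ℓ t ≠ 0 := by
    have hc : Continuous ℓ := by fun_prop
    have : ℓ ⁻¹' {z : E | z ≠ 0} ∈ 𝓝 (0 : ℝ) :=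
      hc.continuousAt.preimage_mem_nhds (isOpen_ne.mem_nhds (by rwa [hℓ0]))
    exact this
  have hconst : (coneExtension p x₀ ∘ ℓ) =ᶠ[𝓝 0] fun _ => coneExtension p x₀ w := by
    filter_upwards [hne] with t ht
    simp only [comp_apply]
    refine (coneExtension_eq_iff hfib w ht).2 ?_
    exact add_mem (mem_fibreSpan_unitVec hw) (smul_mem _ _ hv)
  have hzero : mfderiv 𝓘(ℝ, ℝ) I' (coneExtension p x₀ ∘ ℓ) 0 = 0 := by
    rw [hconst.mfderiv_eq]; exact mfderiv_const
  -- chain rule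
  have h1 : MDifferentiableAt 𝓘(ℝ, E) I' (coneExtension p x₀) (ℓ 0) := by
    rw [hℓ0]
    exact (contMDiffAt_coneExtension hp hw).mdifferentiableAt one_ne_zero
  have h2 : MDifferentiableAt 𝓘(ℝ, ℝ) 𝓘(ℝ, E) ℓ 0 :=
    ((contDiff_const.add (contDiff_id.smul contDiff_const)).contMDiff (n := 1) 0).mdifferentiableAt
      one_ne_zero
  have hcomp := mfderiv_comp 0 h1 h2
  rw [hzero, hℓ0] at hcomp
  have h3 : (0 : ℝ →L[ℝ] E') (1 : ℝ) =
      (mfderiv 𝓘(ℝ, E) I' (coneExtension p x₀) w) (mfderiv 𝓘(ℝ, ℝ) 𝓘(ℝ, E) ℓ 0 (1 : ℝ)) :=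
    congrArg (fun f => f (1 : ℝ)) hcomp
  rw [mfderiv_lineMap_apply_one] at h3
  exact h3.symm

variable [TopologicalSpace M] [ChartedSpace (EuclideanSpace ℝ (Fin k)) M]

include hfib in
set_option backward.isDefEq.respectTransparency false in
/-- **The kernel of `d𝒫` is the fibre subspace** (the converse inclusion): for a `C¹` submersion
`p` with `k`-dimensional great-sphere fibres in `dim E = 2k`, if `d𝒫_w v = 0` (`w ≠ 0`) then
`v ∈ V_{w/‖w‖}`. Indeed `d𝒫_w = dp ∘ d(unitVec)_w` is onto `ℝᵏ`, so `dim ker d𝒫_w = 2k - k = k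
= dim V_{w/‖w‖}`, and `V_{w/‖w‖} ⊆ ker d𝒫_w` by `mfderiv_coneExtension_apply_eq_zero`
(Hähl 2.7: "the subspace in question is also spanned by the tangent space of the fibre together
with the point itself"). [cite: Hahl1987, 2.7] -/
theorem mem_fibreSpan_of_mfderiv_coneExtension_eq_zero [IsManifold (𝓡 k) 1 M]
    (hE : finrank ℝ E = 2 * k) (hp : ContMDiff (𝓡 d) (𝓡 k) 1 p)
    (hsubm : ∀ x, Surjective (mfderiv (𝓡 d) (𝓡 k) p x)) {w : E} (hw : w ≠ 0) {v : E}
    (hv : mfderiv 𝓘(ℝ, E) (𝓡 k) (coneExtension p x₀) w v = 0) :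
    v ∈ fibreSpan p (unitVec x₀ w) := by
  haveI : FiniteDimensional ℝ E := Module.finite_of_finrank_eq_succ (Fact.out : finrank ℝ E = d + 1)
  set f : E →L[ℝ] EuclideanSpace ℝ (Fin k) := mfderiv 𝓘(ℝ, E) (𝓡 k) (coneExtension p x₀) w
    with hf
  -- `f` is onto
  have hsurj : Surjective f := by
    have h1 : MDifferentiableAt (𝓡 d) (𝓡 k) p (unitVec x₀ w) := (hp _).mdifferentiableAt one_ne_zero
    have h2 : MDifferentiableAt 𝓘(ℝ, E) (𝓡 d) (unitVec x₀) w :=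
      (contMDiffAt_unitVec (m := 1) hw).mdifferentiableAt one_ne_zero
    have hcomp : f = (mfderiv (𝓡 d) (𝓡 k) p (unitVec x₀ w)).comp
        (mfderiv 𝓘(ℝ, E) (𝓡 d) (unitVec x₀) w) := mfderiv_comp w h1 h2
    rw [hcomp]
    exact (hsubm _).comp (surjective_mfderiv_unitVec hw)
  -- dimension count
  set K : Submodule ℝ E := LinearMap.ker (f : E →ₗ[ℝ] EuclideanSpace ℝ (Fin k)) with hK
  have hrank := LinearMap.finrank_range_add_finrank_ker (f : E →ₗ[ℝ] EuclideanSpace ℝ (Fin k))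
  rw [LinearMap.range_eq_top.2 hsurj, finrank_top, finrank_euclideanSpace_fin, hE] at hrank
  have hKk : finrank ℝ K = k := by rw [hK]; omega
  have hle : fibreSpan p (unitVec x₀ w) ≤ K := fun u hu =>
    (LinearMap.mem_ker).2 (mfderiv_coneExtension_apply_eq_zero hfib hp hw hu)
  have heq : fibreSpan p (unitVec x₀ w) = K :=
    Submodule.eq_of_le_of_finrank_eq hle (by rw [finrank_fibreSpan hfib, hKk])
  have hvK : v ∈ K := (LinearMap.mem_ker).2 hv
  rwa [← heq] at hvK

include hfib in
set_option backward.isDefEq.respectTransparency false in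
/-- **`ker d𝒫_w = V_{w/‖w‖}`**, pointwise form. [cite: Hahl1987, 2.7] -/
theorem mfderiv_coneExtension_apply_eq_zero_iff [IsManifold (𝓡 k) 1 M]
    (hE : finrank ℝ E = 2 * k) (hp : ContMDiff (𝓡 d) (𝓡 k) 1 p)
    (hsubm : ∀ x, Surjective (mfderiv (𝓡 d) (𝓡 k) p x)) {w : E} (hw : w ≠ 0) (v : E) :
    mfderiv 𝓘(ℝ, E) (𝓡 k) (coneExtension p x₀) w v = 0 ↔ v ∈ fibreSpan p (unitVec x₀ w) :=
  ⟨mem_fibreSpan_of_mfderiv_coneExtension_eq_zero hfib hE hp hsubm hw,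
    mfderiv_coneExtension_apply_eq_zero hfib hp hw⟩

set_option backward.isDefEq.respectTransparency false in
/-- **`d𝒫_w` is onto** for a submersion `p` (`w ≠ 0`). [cite: Hahl1987, 2.7] -/
theorem surjective_mfderiv_coneExtension [IsManifold (𝓡 k) 1 M] (hp : ContMDiff (𝓡 d) (𝓡 k) 1 p)
    (hsubm : ∀ x, Surjective (mfderiv (𝓡 d) (𝓡 k) p x)) {w : E} (hw : w ≠ 0) :
    Surjective (mfderiv 𝓘(ℝ, E) (𝓡 k) (coneExtension p x₀) w) := by
  have h1 : MDifferentiableAt (𝓡 d) (𝓡 k) p (unitVec x₀ w) := (hp _).mdifferentiableAt one_ne_zero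
  have h2 : MDifferentiableAt 𝓘(ℝ, E) (𝓡 d) (unitVec x₀) w :=
    (contMDiffAt_unitVec (m := 1) hw).mdifferentiableAt one_ne_zero
  have hcomp : mfderiv 𝓘(ℝ, E) (𝓡 k) (coneExtension p x₀) w =
      (mfderiv (𝓡 d) (𝓡 k) p (unitVec x₀ w)).comp (mfderiv 𝓘(ℝ, E) (𝓡 d) (unitVec x₀) w) :=
    mfderiv_comp w h1 h2
  rw [hcomp]
  exact (hsubm _).comp (surjective_mfderiv_unitVec hw)

end Kernel

end Literature.Geometry.Riemannian

end
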